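import Summits.ResolutionOfSingularities.KangarooAtlas.MizutaniExpandTransport
import HarnessLib

/-!
# The Frobenius image of a Hironaka scheme (Mizutani 1973, Lemma 2.7) — scheme half

Cell `pub-rosobs`, Mizutani enclosure (seat mizutani-encloser-2, gen 9). AI-written; *AI review is weaker than expert
review*; NOT a resolution-of-singularities theorem (summit relevance C).

> **Mizutani 1973, Lemma 2.7 (p. 89–90).** "Let `H = H(V, W)` be an H-scheme with `e(H) ≥ 1`. When `0 ≤ e' ≤ e`,
> `H' = H(V, W')` is an H-scheme with `e(H') = e'` and `dim H' = dim H`, where `W' = k^{p^{e'}} ⊗_{k^{p^e}} W`. […]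
> This lemma means that the image `H'` of `H` by the Frobenius morphism `F^{e−e'}` of the ambient vector group defined
> by `(x_0, …, x_n) → (x_0^{p^{e−e'}}, …, x_n^{p^{e−e'}})` is again an H-scheme of exponent `e'`."

For a point `𝔭` of `ℙ^n_k` with Hironaka scheme `B_{P,𝔭} = Spec S/U_+(𝔭)S ⊆ Spec S = 𝔸^{n+1}` (`bIdeal k 𝔭 = U_+(𝔭)S`,
`hirForms k p 𝔭 j = (U(𝔭) ∩ L)_j` on coefficient vectors), the scheme-theoretic image of `B_{P,𝔭}` under the `k`-morphism
`F^m : (x_i) ↦ (x_i^{p^m})` of `𝔸^{n+1}` is the closed subscheme with ideal `(U_+(𝔭)S).comap (expand p^m)`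
(`MvPolynomial.expand (p^m) : Y_i ↦ X_i^{p^m}`).  This file proves, for EVERY point and every `m`:

* **`comap_expand_bIdeal`** — `(U_+(𝔭)S).comap (expand p^m) = (Σ_i a_i Y_i^{p^j} : j ≥ 0, a ∈ (U(𝔭) ∩ L)_{j+m})`:
  the Frobenius image `F^m(B_{P,𝔭})` is cut out by the SHIFTED invariant additive forms (`famIdeal` of the family
  `j ↦ (U ∩ L)_{j+m}`).  Engine: `comap_expand_pow_famIdeal` of `MizutaniExpandShift.lean` / `MizutaniExpandTransport.lean`
  (for every `F`-stable levelwise family `N`: the `k[X^p]`-linear retraction `rootPart` of `expand p`, `F`-stability, and a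
  projective coordinate change putting the linear forms `N 0` on coordinate vectors) and `U_+(𝔭)S = famIdeal (U(𝔭) ∩ L)`
  (`bIdeal_eq_famIdeal_hirForms_holds`, Hironaka's generation theorem);
* **`ringKrullDim_quotient_comap_expand_bIdeal`** — `dim F^m(B_{P,𝔭}) = dim B_{P,𝔭}` («`dim H' = dim H`»);
* `aeval_pow_eq_zero_of_mem_comap_expand` (`F^m` maps `B_{P,𝔭}(k')` into the image), `isHomogeneousIdeal_comap_expand_bIdeal`,
  `mem_ridge_comap_expand_bIdeal_iff`, `comap_expand_bIdeal_aeval_add` — the image is a homogeneous additive subgroup scheme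
  (its own Giraud ridge, `MizutaniGroupScheme`);
* `shift_eq_span_frobVec_image` — the shifted family is generated from level `exponent − m` («`e(H') = e'`», on the forms);
* **`comap_expand_bIdeal_eq_span_inter_one_iff`** — `F^m(B_{P,𝔭})` is defined by LINEAR forms iff `exponent B(𝔭) ≤ m`:
  the exponent is the number of Frobenius steps needed to flatten `B_{P,𝔭}` into a vector group
  (`exponent_le_iff_comap_expand_linear`);
* **`exists_point_bIdeal_eq_comap_expand`** — Lemma 2.7 with `e' = 0` IN FULL: for `m ≥ exponent B(𝔭)` the image `F^m(B_{P,𝔭})`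
  IS the Hironaka scheme `B_{P,𝔩}` of the point `𝔩 = ((U(𝔭) ∩ L)_m-linear forms)` (prime, homogeneous, `≠ S_+`), a vector
  group with `(L_B)_j(𝔩) = (L_B)_{j+m}(𝔭)` for all `j`, exponent `0` and `dim B(𝔩) = dim B(𝔭)`.

NOT CLAIMED here: that `F^m(B_{P,𝔭})` is the Hironaka scheme of a point when `1 ≤ e' = exponent − m` (Mizutani's H-scheme
property of the image in positive exponent; his proof uses Lemma 2.4 `Diff_{q−1} = Diff_{q−q'}·Diff_{q'−1}` and Oda 1973
Lemma 2.9, not in the tree).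

## References

* H. Mizutani, *Hironaka's additive group schemes*, Nagoya Math. J. 52 (1973) 85–95, Lemma 2.7 (p. 89–90), §1 (c), Thm. 1.3,
  Remark 2.10 (`m(1) ≤ m(2) ≤ ⋯`). [Mizutani1973HironakaGroupSchemes]
* T. Oda, *Hironaka's additive group scheme, II*, Publ. RIMS 19 (1983), §2 (p. 1168: `L_B`, exponent, `dim B`). [Oda1983HironakaGroupSchemeII]
-/

noncomputable section

open MvPolynomial Literature.AlgebraicGeometry.Resolution Literature.AlgebraicGeometry.Resolution.HironakaScheme
  Literature.RingTheory.MvPolynomial Literature.RingTheory.HilbertSamuel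

namespace Summit.ResolutionOfSingularities.KangarooAtlas.Mizutani

universe u

/-! ## The Frobenius image of `B_{P,𝔭}` -/

section Point

variable (k : Type u) [Field k] (p : ℕ) [hp : Fact p.Prime] [CharP k p] {n : ℕ}
  (𝔭 : Ideal (MvPolynomial (Fin (n + 1)) k))

/-- **THE FROBENIUS IMAGE OF A HIRONAKA SCHEME IS CUT OUT BY THE SHIFTED INVARIANT FORMS**: for every point `𝔭` of
`ℙ^n_k` and every `m`, `(U_+(𝔭)S).comap (expand p^m) = (Σ_i a_i Y_i^{p^j} : j ≥ 0, a ∈ (U(𝔭) ∩ L)_{j+m})` — the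
scheme-theoretic image of `B_{P,𝔭}` under `F^m : (x_i) ↦ (x_i^{p^m})` is the subgroup scheme of `𝔸^{n+1}` defined by the
additive forms of `U(𝔭)` of level `≥ m`, their level lowered by `m`. [cite: Mizutani1973HironakaGroupSchemes, Lemma 2.7 (p. 90)] -/
theorem comap_expand_bIdeal [𝔭.IsPrime] (hP : IsPoint k 𝔭) (m : ℕ) :
    (bIdeal k 𝔭).comap (expand (p ^ m) : MvPolynomial (Fin (n + 1)) k →ₐ[k] MvPolynomial (Fin (n + 1)) k) =
      famIdeal k p (fun j => hirForms k p 𝔭 (j + m)) := by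
  rw [bIdeal_eq_famIdeal_hirForms_holds k p 𝔭 hP]
  exact comap_expand_pow_famIdeal k p (fun _ m _ ha => frobVec_mem_hirForms m ha) m

/-- The additive forms of the Frobenius image: `Σ a_i Y_i^{p^j}` lies in the ideal of `F^m(B_{P,𝔭})` iff
`a ∈ (U(𝔭) ∩ L)_{j+m}` (`L_e ∩ U_+(𝔭)S = (U ∩ L)_e`, `addForm_mem_bIdeal_iff`). [cite: Mizutani1973HironakaGroupSchemes, Lemma 2.7] -/
theorem addForm_mem_comap_expand_bIdeal_iff [𝔭.IsPrime] (hP : IsPoint k 𝔭) (m j : ℕ) (a : Fin (n + 1) → k) :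
    addForm k p j a ∈ (bIdeal k 𝔭).comap
        (expand (p ^ m) : MvPolynomial (Fin (n + 1)) k →ₐ[k] MvPolynomial (Fin (n + 1)) k) ↔
      a ∈ hirForms k p 𝔭 (j + m) := by
  rw [Ideal.mem_comap, expand_addForm, addForm_mem_bIdeal_iff k p 𝔭 hP]

/-- **`dim F^m(B_{P,𝔭}) = dim B_{P,𝔭}`** («`dim H' = dim H`»): the Frobenius image has the Krull dimension of `B_{P,𝔭}`
(both are `(n+1) − dim_k (U(𝔭) ∩ L)_{e}` for `e` large, `F` being injective on forms).
[cite: Mizutani1973HironakaGroupSchemes, Lemma 2.7 (p. 89: "dim H' = dim H")] -/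
theorem ringKrullDim_quotient_comap_expand_bIdeal [𝔭.IsPrime] (hP : IsPoint k 𝔭) (m : ℕ) :
    ringKrullDim (MvPolynomial (Fin (n + 1)) k ⧸ (bIdeal k 𝔭).comap
        (expand (p ^ m) : MvPolynomial (Fin (n + 1)) k →ₐ[k] MvPolynomial (Fin (n + 1)) k)) =
      ringKrullDim (MvPolynomial (Fin (n + 1)) k ⧸ bIdeal k 𝔭) := by
  set E := exponent k p 𝔭 with hEdef
  have hexp : ExponentLE k p 𝔭 (E + m) := (exponentLE_exponent k p 𝔭).mono (Nat.le_add_right E m)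
  have hgen := (exponentLE_iff_hirForms 𝔭 (E + m)).mp hexp
  have hF' : ∀ e m', ∀ a ∈ (fun j => hirForms k p 𝔭 (j + m)) e,
      frobVec k p m' a ∈ (fun j => hirForms k p 𝔭 (j + m)) (e + m') := by
    intro e m' a ha
    have h := frobVec_mem_hirForms (p := p) m' ha
    rwa [Nat.add_right_comm] at h
  have hgen' : ∀ j, E ≤ j → (fun j => hirForms k p 𝔭 (j + m)) j ≤
      Submodule.span k (frobVec k p (j - E) ''
        ((fun j => hirForms k p 𝔭 (j + m)) E : Set (Fin (n + 1) → k))) := by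
    intro j hj
    have h := hgen (j + m) (by omega)
    have hsub : j + m - (E + m) = j - E := by omega
    rw [hsub] at h
    exact h.le
  rw [comap_expand_bIdeal k p 𝔭 hP m, ringKrullDim_quotient_famIdeal k p hF' hgen',
    ringKrullDim_quotient_bIdeal_holds k p 𝔭 hP (fun j hj => (hgen j hj).le)]

/-- Hence `dim F^m(B_{P,𝔭}) = hsDim k p 𝔭` (Oda's formula). [cite: Mizutani1973HironakaGroupSchemes, Lemma 2.7 and Thm. 1.3] -/
theorem ringKrullDim_quotient_comap_expand_bIdeal_eq_hsDim [𝔭.IsPrime] (hP : IsPoint k 𝔭) (m : ℕ) :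
    ringKrullDim (MvPolynomial (Fin (n + 1)) k ⧸ (bIdeal k 𝔭).comap
        (expand (p ^ m) : MvPolynomial (Fin (n + 1)) k →ₐ[k] MvPolynomial (Fin (n + 1)) k)) =
      (hsDim k p 𝔭 : WithBot ℕ∞) := by
  rw [ringKrullDim_quotient_comap_expand_bIdeal k p 𝔭 hP m, ringKrullDim_quotient_bIdeal_eq_hsDim_holds k p 𝔭 hP]

/-- **«`e(H') = e − m`», on the forms**: if `exponent B(𝔭) ≤ e` and `m ≤ e`, the shifted family `j ↦ (U ∩ L)_{j+m}` is
generated by `F` from level `e − m`. [cite: Mizutani1973HironakaGroupSchemes, Lemma 2.7 (p. 89: "e(H') = e'")] -/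
theorem shift_eq_span_frobVec_image [𝔭.IsPrime] {e m : ℕ} (hE : ExponentLE k p 𝔭 e) (hm : m ≤ e) :
    ∀ j, e - m ≤ j → hirForms k p 𝔭 (j + m) =
      Submodule.span k (frobVec k p (j - (e - m)) '' (hirForms k p 𝔭 (e - m + m) : Set (Fin (n + 1) → k))) := by
  intro j hj
  have h := (exponentLE_iff_hirForms 𝔭 e).mp hE (j + m) (by omega)
  have h1 : e - m + m = e := Nat.sub_add_cancel hm
  have h2 : j + m - e = j - (e - m) := by omega
  rw [h1, ← h2]
  exact h

/-- Conversely, if the shifted family is generated by `F` from level `e'`, then `exponent B(𝔭) ≤ e' + m`: the exact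
exponent of the image family is `exponent B(𝔭) − m`. [cite: Mizutani1973HironakaGroupSchemes, Lemma 2.7] -/
theorem exponentLE_of_shift_eq_span [𝔭.IsPrime] {e' m : ℕ}
    (h : ∀ j, e' ≤ j → hirForms k p 𝔭 (j + m) =
      Submodule.span k (frobVec k p (j - e') '' (hirForms k p 𝔭 (e' + m) : Set (Fin (n + 1) → k)))) :
    ExponentLE k p 𝔭 (e' + m) := by
  rw [exponentLE_iff_hirForms]
  intro j hj
  obtain ⟨i, rfl⟩ := Nat.exists_eq_add_of_le hj
  have h1 := h (e' + i) (Nat.le_add_right _ _)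
  have h2 : e' + i + m = e' + m + i := by omega
  have h3 : e' + i - e' = e' + m + i - (e' + m) := by omega
  rw [h2, h3] at h1
  exact h1

/-! ### The image is a homogeneous additive subgroup scheme of `𝔸^{n+1}`, and `F^m` maps `B_{P,𝔭}` into it -/

omit hp [CharP k p] in
/-- **`F^m` maps `B_{P,𝔭}(k')` into the image**: if `v ∈ (k')^{n+1}` is a zero of `U_+(𝔭)S` then `(v_i^{p^m})_i` is a zero
of the image ideal (`g(v^{p^m}) = (expand p^m g)(v)`), for every commutative `k`-algebra `k'`.
[cite: Mizutani1973HironakaGroupSchemes, Lemma 2.7 (p. 90: the image by the Frobenius morphism of the ambient vector group)] -/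
theorem aeval_pow_eq_zero_of_mem_comap_expand {k' : Type*} [CommRing k'] [Algebra k k'] (m : ℕ)
    {v : Fin (n + 1) → k'} (hv : ∀ f ∈ bIdeal k 𝔭, aeval v f = 0) :
    ∀ g ∈ (bIdeal k 𝔭).comap
        (expand (p ^ m) : MvPolynomial (Fin (n + 1)) k →ₐ[k] MvPolynomial (Fin (n + 1)) k),
      aeval (v ^ p ^ m) g = 0 := by
  intro g hg
  rw [← aeval_expand]
  exact hv _ (Ideal.mem_comap.mp hg)

/-- The image ideal is HOMOGENEOUS (generated by forms). [cite: Mizutani1973HironakaGroupSchemes, Def. 1.1 and Lemma 2.7] -/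
theorem isHomogeneousIdeal_comap_expand_bIdeal [𝔭.IsPrime] (hP : IsPoint k 𝔭) (m : ℕ) :
    IsHomogeneousIdeal ((bIdeal k 𝔭).comap
      (expand (p ^ m) : MvPolynomial (Fin (n + 1)) k →ₐ[k] MvPolynomial (Fin (n + 1)) k)) := by
  rw [comap_expand_bIdeal k p 𝔭 hP m]
  exact isHomogeneousIdeal_famIdeal k p _

/-- **`F^m(B_{P,𝔭})` is its own ridge — an additive SUBGROUP functor of `𝔸^{n+1}` and a cone**: for every commutative
`k`-algebra `k'`, a point `v ∈ (k')^{n+1}` translates the image scheme into itself iff it lies on it (Giraud's ridge functor of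
the tree; the image ideal is generated by additive forms). [cite: Mizutani1973HironakaGroupSchemes, Def. 1.1 («homogeneous additive subgroup scheme») and Lemma 2.7] -/
theorem mem_ridge_comap_expand_bIdeal_iff [𝔭.IsPrime] (hP : IsPoint k 𝔭) (m : ℕ) {k' : Type*} [CommRing k']
    [Algebra k k'] {v : Fin (n + 1) → k'} :
    v ∈ ridge k' ((bIdeal k 𝔭).comap
        (expand (p ^ m) : MvPolynomial (Fin (n + 1)) k →ₐ[k] MvPolynomial (Fin (n + 1)) k)) ↔
      ∀ f ∈ (bIdeal k 𝔭).comap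
        (expand (p ^ m) : MvPolynomial (Fin (n + 1)) k →ₐ[k] MvPolynomial (Fin (n + 1)) k), aeval v f = 0 := by
  rw [comap_expand_bIdeal k p 𝔭 hP m]
  exact mem_ridge_famIdeal_iff k p _

/-- The `k'`-points of `F^m(B_{P,𝔭})` are closed under addition. [cite: Mizutani1973HironakaGroupSchemes, Def. 1.1 and Lemma 2.7] -/
theorem comap_expand_bIdeal_aeval_add [𝔭.IsPrime] (hP : IsPoint k 𝔭) (m : ℕ) {k' : Type*} [CommRing k']
    [Algebra k k'] {v w : Fin (n + 1) → k'}
    (hv : ∀ f ∈ (bIdeal k 𝔭).comap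
      (expand (p ^ m) : MvPolynomial (Fin (n + 1)) k →ₐ[k] MvPolynomial (Fin (n + 1)) k), aeval v f = 0)
    (hw : ∀ f ∈ (bIdeal k 𝔭).comap
      (expand (p ^ m) : MvPolynomial (Fin (n + 1)) k →ₐ[k] MvPolynomial (Fin (n + 1)) k), aeval w f = 0) :
    ∀ f ∈ (bIdeal k 𝔭).comap
      (expand (p ^ m) : MvPolynomial (Fin (n + 1)) k →ₐ[k] MvPolynomial (Fin (n + 1)) k), aeval (v + w) f = 0 := by
  rw [comap_expand_bIdeal k p 𝔭 hP m] at hv hw ⊢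
  exact famIdeal_aeval_add k p _ hv hw

/-! ### When is the Frobenius image a vector group? -/

/-- The LINEAR forms of the ideal of `F^m(B_{P,𝔭})` are the `Σ v_i Y_i` with `v ∈ (U(𝔭) ∩ L)_m`. [cite: Mizutani1973HironakaGroupSchemes, Lemma 2.7 and Rem. 1.2] -/
theorem comap_expand_bIdeal_inter_one [𝔭.IsPrime] (hP : IsPoint k 𝔭) (m : ℕ) :
    ((bIdeal k 𝔭).comap
          (expand (p ^ m) : MvPolynomial (Fin (n + 1)) k →ₐ[k] MvPolynomial (Fin (n + 1)) k) :
        Set (MvPolynomial (Fin (n + 1)) k)) ∩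
        (homogeneousSubmodule (Fin (n + 1)) k 1 : Set (MvPolynomial (Fin (n + 1)) k)) =
      linForm '' (hirForms k p 𝔭 m : Set (Fin (n + 1) → k)) := by
  ext f
  constructor
  · rintro ⟨hf, hf1⟩
    have hf1' : f ∈ LinearMap.range (linForm (K := k) (n := n + 1)) := by rw [range_linForm]; exact hf1
    obtain ⟨v, rfl⟩ := hf1'
    refine ⟨v, ?_, rfl⟩
    rw [SetLike.mem_coe, Ideal.mem_comap, linForm_eq_addForm_zero k p, expand_addForm, Nat.zero_add,
      addForm_mem_bIdeal_iff k p 𝔭 hP] at hf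
    exact hf
  · rintro ⟨v, hv, rfl⟩
    refine ⟨?_, ?_⟩
    · rw [SetLike.mem_coe, Ideal.mem_comap, linForm_eq_addForm_zero k p, expand_addForm, Nat.zero_add,
        addForm_mem_bIdeal_iff k p 𝔭 hP]
      exact hv
    · have h : linForm v ∈ LinearMap.range (linForm (K := k) (n := n + 1)) := ⟨v, rfl⟩
      rw [range_linForm] at h
      exact h

/-- If `exponent B(𝔭) ≤ m`, the Frobenius image `F^m(B_{P,𝔭})` is the LINEAR subspace `V(Σ v_i Y_i : v ∈ (U ∩ L)_m)`.
[cite: Mizutani1973HironakaGroupSchemes, Lemma 2.7 (e' = 0) and Rem. 1.2] -/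
theorem comap_expand_bIdeal_eq_span_linForm [𝔭.IsPrime] (hP : IsPoint k 𝔭) {m : ℕ} (hE : ExponentLE k p 𝔭 m) :
    (bIdeal k 𝔭).comap (expand (p ^ m) : MvPolynomial (Fin (n + 1)) k →ₐ[k] MvPolynomial (Fin (n + 1)) k) =
      Ideal.span (linForm '' (hirForms k p 𝔭 m : Set (Fin (n + 1) → k))) := by
  refine le_antisymm ?_ ?_
  · rw [comap_expand_bIdeal k p 𝔭 hP m]
    unfold famIdeal
    rw [Ideal.span_le]
    rintro _ ⟨_, ⟨j, rfl⟩, ⟨a, ha, rfl⟩⟩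
    have ha : a ∈ hirForms k p 𝔭 (j + m) := ha
    have hgen := (exponentLE_iff_hirForms 𝔭 m).mp hE (j + m) (Nat.le_add_left m j)
    rw [Nat.add_sub_cancel] at hgen
    rw [hgen, ← pointForms_span_linForm k p (hirForms k p 𝔭 m) j, mem_pointForms_iff] at ha
    exact ha
  · rw [Ideal.span_le]
    rintro _ ⟨v, hv, rfl⟩
    rw [SetLike.mem_coe, Ideal.mem_comap, linForm_eq_addForm_zero k p, expand_addForm, Nat.zero_add,
      addForm_mem_bIdeal_iff k p 𝔭 hP]
    exact hv

/-- **`F^m(B_{P,𝔭})` IS A VECTOR GROUP (its ideal is generated by its linear forms) IFF `exponent B(𝔭) ≤ m`**: the exponent of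
a Hironaka scheme is the number of Frobenius steps needed to flatten it into a linear subspace.
[cite: Mizutani1973HironakaGroupSchemes, Lemma 2.7 and Rem. 1.2 («B is a vector group iff the exponent of B equals 0»)] -/
theorem comap_expand_bIdeal_eq_span_inter_one_iff [𝔭.IsPrime] (hP : IsPoint k 𝔭) (m : ℕ) :
    (bIdeal k 𝔭).comap (expand (p ^ m) : MvPolynomial (Fin (n + 1)) k →ₐ[k] MvPolynomial (Fin (n + 1)) k) =
        Ideal.span (((bIdeal k 𝔭).comap
            (expand (p ^ m) : MvPolynomial (Fin (n + 1)) k →ₐ[k] MvPolynomial (Fin (n + 1)) k) :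
            Set (MvPolynomial (Fin (n + 1)) k)) ∩
          (homogeneousSubmodule (Fin (n + 1)) k 1 : Set (MvPolynomial (Fin (n + 1)) k))) ↔
      ExponentLE k p 𝔭 m := by
  rw [comap_expand_bIdeal_inter_one k p 𝔭 hP m]
  constructor
  · intro h
    rw [exponentLE_iff_hirForms]
    intro j hj
    obtain ⟨i, rfl⟩ := Nat.exists_eq_add_of_le hj
    rw [Nat.add_sub_cancel_left]
    refine le_antisymm ?_ (span_frobVec_image_hirForms_le i m)
    intro a ha
    have h1 : addForm k p i a ∈ (bIdeal k 𝔭).comap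
        (expand (p ^ m) : MvPolynomial (Fin (n + 1)) k →ₐ[k] MvPolynomial (Fin (n + 1)) k) := by
      rw [addForm_mem_comap_expand_bIdeal_iff k p 𝔭 hP, Nat.add_comm i m]
      exact ha
    rw [h, ← mem_pointForms_iff, pointForms_span_linForm] at h1
    exact h1
  · intro hE
    exact comap_expand_bIdeal_eq_span_linForm k p 𝔭 hP hE

/-- The same with Oda's exponent: **`exponent B(𝔭) ≤ m` iff `F^m(B_{P,𝔭})` is defined by linear forms.**
[cite: Mizutani1973HironakaGroupSchemes, §1 (c), Rem. 1.2, Lemma 2.7] -/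
theorem exponent_le_iff_comap_expand_linear [𝔭.IsPrime] (hP : IsPoint k 𝔭) (m : ℕ) :
    exponent k p 𝔭 ≤ m ↔
      (bIdeal k 𝔭).comap (expand (p ^ m) : MvPolynomial (Fin (n + 1)) k →ₐ[k] MvPolynomial (Fin (n + 1)) k) =
        Ideal.span (((bIdeal k 𝔭).comap
            (expand (p ^ m) : MvPolynomial (Fin (n + 1)) k →ₐ[k] MvPolynomial (Fin (n + 1)) k) :
            Set (MvPolynomial (Fin (n + 1)) k)) ∩
          (homogeneousSubmodule (Fin (n + 1)) k 1 : Set (MvPolynomial (Fin (n + 1)) k))) := by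
  rw [exponent_le_iff, comap_expand_bIdeal_eq_span_inter_one_iff k p 𝔭 hP m]

/-! ### Lemma 2.7 with `e' = 0`: the image is the Hironaka scheme of a linear point -/

/-- The ideal `(Σ v_i X_i : v ∈ (U(𝔭) ∩ L)_m)` is a point of `ℙ^n_k` (prime, homogeneous, not containing `S_+`: if every
`X_i` were in it, every `X_i^{p^m}` would lie in `U_+(𝔭)S ⊆ 𝔭`). [cite: Mizutani1973HironakaGroupSchemes, Lemma 2.7] -/
theorem isPoint_span_linForm_hirForms [𝔭.IsPrime] (hP : IsPoint k 𝔭) (m : ℕ) :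
    IsPoint k (Ideal.span (linForm '' (hirForms k p 𝔭 m : Set (Fin (n + 1) → k)))) := by
  refine ⟨isPrime_span_linForm (hirForms k p 𝔭 m), fun f hf d => ?_, fun hle => ?_⟩
  · exact isHomogeneousIdeal_span_of_isHomogeneous
      (by rintro _ ⟨g, -, rfl⟩; exact ⟨1, isHomogeneous_linForm g⟩) f hf d
  · apply hP.2.2
    refine irrelevant_le_of_X_mem k fun i => ?_
    have hXi : (X i : MvPolynomial (Fin (n + 1)) k) ∈
        Ideal.span (linForm '' (hirForms k p 𝔭 m : Set (Fin (n + 1) → k))) :=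
      hle (by unfold irrelevant; rw [RingHom.mem_ker, constantCoeff_X])
    have hXi' : (Pi.single i 1 : Fin (n + 1) → k) ∈ hirForms k p 𝔭 m := by
      have h0 := pointForms_span_linForm k p (hirForms k p 𝔭 m) 0
      rw [span_frobVec_zero_image] at h0
      rw [← h0, mem_pointForms_iff, ← linForm_eq_addForm_zero k p, linForm_single]
      exact hXi
    have h := (addForm_mem_bIdeal_iff k p 𝔭 hP).mpr hXi'
    have hX : addForm k p (0 + m) (Pi.single i (1 : k)) = X i ^ p ^ m := by
      rw [← expand_addForm, addForm_zero_eq_linForm, linForm_single, expand_X]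
    rw [Nat.zero_add] at hX
    rw [hX] at h
    exact ‹𝔭.IsPrime›.mem_of_pow_mem _ (bIdeal_le h)

/-- **`F^m(B_{P,𝔭}) = B_{P,𝔩}` for the linear point `𝔩 = (Σ v_i X_i : v ∈ (U(𝔭) ∩ L)_m)` when `exponent B(𝔭) ≤ m`**
(`U_+(𝔩)S = 𝔩` for a point generated by linear forms, `bIdeal_eq_self_iff`). [cite: Mizutani1973HironakaGroupSchemes, Lemma 2.7 (e' = 0)] -/
theorem bIdeal_span_linForm_hirForms_eq [𝔭.IsPrime] (hP : IsPoint k 𝔭) {m : ℕ} (hE : ExponentLE k p 𝔭 m) :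
    bIdeal k (Ideal.span (linForm '' (hirForms k p 𝔭 m : Set (Fin (n + 1) → k)))) =
      (bIdeal k 𝔭).comap (expand (p ^ m) : MvPolynomial (Fin (n + 1)) k →ₐ[k] MvPolynomial (Fin (n + 1)) k) := by
  haveI := isPrime_span_linForm (hirForms k p 𝔭 m)
  have hself : bIdeal k (Ideal.span (linForm '' (hirForms k p 𝔭 m : Set (Fin (n + 1) → k)))) =
      Ideal.span (linForm '' (hirForms k p 𝔭 m : Set (Fin (n + 1) → k))) := by
    refine (bIdeal_eq_self_iff k p _ (isPoint_span_linForm_hirForms k p 𝔭 hP m)).mpr ?_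
    refine le_antisymm (Ideal.span_le.mpr ?_) (Ideal.span_le.mpr fun f hf => hf.1)
    rintro _ ⟨v, hv, rfl⟩
    refine Ideal.subset_span ⟨Ideal.subset_span ⟨v, hv, rfl⟩, ?_⟩
    have h : linForm v ∈ LinearMap.range (linForm (K := k) (n := n + 1)) := ⟨v, rfl⟩
    rw [range_linForm] at h
    exact h
  rw [hself, comap_expand_bIdeal_eq_span_linForm k p 𝔭 hP hE]

/-- **LEMMA 2.7 WITH `e' = 0`, IN FULL**: for a point `𝔭` of `ℙ^n_k` with `exponent B(𝔭) ≤ m`, the Frobenius image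
`F^m(B_{P,𝔭})` is the Hironaka scheme `B_{P,𝔩}` of a point `𝔩` of `ℙ^n_k` (the linear point of `(U(𝔭) ∩ L)_m`); it is a
vector group, its invariant forms are the shifted ones `(L_B)_j(𝔩) = (L_B)_{j+m}(𝔭)`, its exponent is `0` and
`dim B(𝔩) = dim B(𝔭)`. [cite: Mizutani1973HironakaGroupSchemes, Lemma 2.7 (p. 89–90) and Rem. 1.2] -/
theorem exists_point_bIdeal_eq_comap_expand [𝔭.IsPrime] (hP : IsPoint k 𝔭) {m : ℕ} (hE : ExponentLE k p 𝔭 m) :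
    ∃ 𝔩 : Ideal (MvPolynomial (Fin (n + 1)) k), IsPoint k 𝔩 ∧
      bIdeal k 𝔩 = (bIdeal k 𝔭).comap
        (expand (p ^ m) : MvPolynomial (Fin (n + 1)) k →ₐ[k] MvPolynomial (Fin (n + 1)) k) ∧
      IsVectorGroup k 𝔩 ∧ (∀ j, invForms k p 𝔩 j = invForms k p 𝔭 (j + m)) ∧ ExponentLE k p 𝔩 0 ∧
      hsDim k p 𝔩 = hsDim k p 𝔭 := by
  haveI := isPrime_span_linForm (hirForms k p 𝔭 m)
  have hpt := isPoint_span_linForm_hirForms k p 𝔭 hP m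
  have hb := bIdeal_span_linForm_hirForms_eq k p 𝔭 hP hE
  have hinv : ∀ j, invForms k p (Ideal.span (linForm '' (hirForms k p 𝔭 m : Set (Fin (n + 1) → k)))) j =
      invForms k p 𝔭 (j + m) := by
    intro j
    rw [invForms_span_linForm, ← hirForms_eq_invForms 𝔭 (j + m),
      (exponentLE_iff_hirForms 𝔭 m).mp hE (j + m) (Nat.le_add_left m j), Nat.add_sub_cancel]
  have hE0 : ExponentLE k p (Ideal.span (linForm '' (hirForms k p 𝔭 m : Set (Fin (n + 1) → k)))) 0 := by
    intro j _
    rw [Nat.sub_zero, invForms_span_linForm, invForms_span_linForm, span_frobVec_zero_image]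
  refine ⟨Ideal.span (linForm '' (hirForms k p 𝔭 m : Set (Fin (n + 1) → k))), hpt, hb, ?_, hinv, hE0, ?_⟩
  · refine isVectorGroup_of_bIdeal_eq_self k p _ hpt ?_
    rw [hb, comap_expand_bIdeal_eq_span_linForm k p 𝔭 hP hE]
  · rw [← hsDimAt_eq_hsDim k p _ hE0, ← hsDimAt_eq_hsDim k p 𝔭 hE]
    unfold hsDimAt
    rw [hinv 0, Nat.zero_add]

end Point

end Summit.ResolutionOfSingularities.KangarooAtlas.Mizutani

end
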